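import Summits.HodgeConjecture.CorCM.IrreducibleOddWeightsIndexParityShadows
import Summits.HodgeConjecture.CorCM.IrreducibleOddWeightsCanonicalPivotTraceExact
import Literature.AlgebraicGeometry.Pohlmann1968.WeilTypeCMSubfieldRankBound
import HarnessLib

/-!
# Index parity, III (CM fields): the defect `dim Hg(A₀) + dim Hg(A₁) − dim Hg(A₀ × A₁)` is a function of the SHADOW of
# `Φ₀` on any subfield `T ⊆ K₀` containing the trace `K₀ ∩ L₁`; the shadows of the CM types of `K₀` are exactly the odd
# weights `w ≡ [K₀:T] (mod 2)`, `|w| ≤ [K₀:T]`; MONOTONE DEFECT SPECTRA in the index within a parity class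

COR-CM (cell `pub-hodgecm2`, binder seat `b16` gen 68, count-neutral claim INDEX PARITY, file P2; theorems only, no
definition, no named fact, no `sorry`).  NEW as stated, hence under `Summits/`.  HONEST FRAMING: Galois theory of CM
fields inside `ℂ` and finite combinatorics of CM types, with consequences for `dim MT(A₀ × A₁)` of abelian varieties with
complex multiplication (Kubota–Dodson rank = `dim MT`, Pohlmann); nothing is claimed about the algebraicity of Hodge
classes; `HC_CM` is neither used nor asserted.

SETTING.  CM fields `K_{i₀}, K_{i₁}` with types `Φ_{i₀}, Φ_{i₁}`, `L₁ = normalClosure ℚ K_{i₁} ℂ`; a subfield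
`T ⊆ K_{i₀}` (`[Algebra T (K i₀)]`) CONTAINING THE TRACE: (TR) `a(k) ∈ L₁ ⟹ k ∈ T` for every embedding `a` (e.g.
`T = K_{i₀}`; `T =` the trace field `a⁻¹(L₁)` itself; any intermediate field).  The SHADOW of `Φ_{i₀}` on `T` is the odd
weight `w₀(y) = Σ_{t|_T = y} u₀(t) = #(Φ_{i₀} ∩ res⁻¹y) − #(Φ̄_{i₀} ∩ res⁻¹y)` on `Hom(T, ℂ)` (Yanai's multiplicities
`(a, b)`, Gordon 9.4.3, are the case of a shadow taking two values); `f₀ = [K_{i₀} : T]`.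

* §1 Restriction to `T` is an `Aut(ℂ)`-equivariant pivot whose fibres REFINE the trace classes under (TR)
  (`exists_stab_smul_eq_of_comp_eq_of_trace_le`, via gen 65 C2 `exists_stab_smul_eq_iff_forall_apply_eq`).
* §2 **THE DEFECT IS A FUNCTION OF THE SHADOW**:
  **`cmTypeRank Φ₀ + cmTypeRank Φ₁ = cmFamilyRank Φ + 1 + dim(span{g ↦ w₀(g ∘ y) : y} ∩ MC₁)`**
  (`cmTypeRank_add_cmTypeRank_eq_cmFamilyRank_add_one_add_finrank_shadow_inf`; additive iff the intersection is `0`,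
  `cmFamilyRank_add_card_eq_pair_iff_shadow_inf_eq_bot`); hence two types of `K_{i₀}` with the same shadow on `T` have
  the same defect against every `Φ₁` (`cmTypeRank_add_cmFamilyRank_eq_of_shadow_eq`) — e.g. a type and the type
  INDUCED from its push-down when the latter is a type (shadow `f₀·t`), or the FIBRE-TWISTED types of file P3.
* §3 **THE SHADOWS OF THE CM TYPES OF `K₀ ⊇ T`** (`T` without real embeddings, `f₀ = [K₀:T]`): every fibre has `f₀`
  points (`card_fibre_eq_finrank`, tree); `w(ȳ) = −w(y)`; `w(y) = 2k − f₀` with `k ≤ f₀` — for ODD `f₀` no entry vanishes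
  (`shadow_ne_zero_of_odd_finrank`), for EVEN `f₀` all entries are even; and SURJECTIVITY
  (**`exists_cmType_forall_card_fibre_inter_eq`**, **`exists_cmType_forall_shadow_eq`**): every `k : Hom(T,ℂ) → ℕ` with
  `k(y) + k(ȳ) = f₀` is the fibre count of a CM type of `K₀` — the shadows are EXACTLY the odd weights `w ≡ f₀ (mod 2)`,
  `|w| ≤ f₀`, i.e. the `f₀`-fold sums of type vectors of `T`.  PADDING (**`exists_cmType_shadow_eq_of_finrank_eq_add`**):
  `K₀, K₀′ ⊇ T` with `[K₀:T] = [K₀′:T] + 2d` ⟹ every shadow of a type of `K₀′` is a shadow of a type of `K₀`.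
* §4 **MONOTONE DEFECT SPECTRA** (`cmTypeRank_add_cmFamilyRank_eq_of_shadow_eq_of_ringEquiv`, two families sharing the
  slot `i₁` up to a ring isomorphism, both satisfying (TR) over the same `T`): equal shadows ⟹ equal defects ACROSS
  FIELDS; with §3: if `[K₀:T] ≥ [K₀′:T]` have the same parity, every defect `dim Hg(A₀′)+dim Hg(A₁)−dim Hg(A₀′×A₁)`
  realised by a type of `K₀′` is realised by a type of `K₀` (**`exists_defect_eq_of_finrank_eq_add`**); in particular
  `Hg(A₀ × A₁) = Hg(A₀) × Hg(A₁)` for ALL types of `(K₀, K₁)` forces the same for `(K₀′, K₁)`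
  (**`forall_additive_of_forall_additive_of_finrank_eq_add`**).  Numerics (kit census of this generation, not a theorem):
  over the D₄ reflex pair `(T₀, T₁)` of quartic CM fields the towers `K₀ = T₀F`, `K₁ = T₁F′` are additive for all types
  iff BOTH indices are odd — positional additivity is governed by the parity of the index over the trace, not by closure
  containment (answering CORE-TOWER's census question in the negative).

## References

* [Gordon1999HodgeAVSurvey] B. B. Gordon, *A survey of the Hodge conjecture for abelian varieties*, §3 Theorem (Imai,
  Murty) with proof, 7.5–7.7, 9.4.3 (Yanai).
* [Lang2002] S. Lang, *Algebra*, 3rd ed., VI §1 Thm. 1.1, Cor. 1.6, V §2 Thm. 2.8.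
* [MilneFT2022] J. S. Milne, *Fields and Galois Theory*, Prop. 2.7 (a) (number of extensions of an embedding).
* [Shimura1998] G. Shimura, *Abelian Varieties with Complex Multiplication and Modular Functions*, §8.1, §18.1, §32.9.
* [Dodson1987] B. Dodson, J. Algebra 111 (1987), §1.1 (rank, lifted types).
-/

set_option autoImplicit false

noncomputable section

open scoped BigOperators Classical

open CategoryTheory CategoryTheory.Limits NumberField Module IntermediateField

namespace Summit.HodgeConjecture.CorCM

open Literature.NumberTheory.ComplexMultiplication
open Literature.AlgebraicGeometry.Motives (AbelianVariety CMType)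
open Literature.AlgebraicGeometry.Motives.AbelianVariety
open Literature.AlgebraicGeometry.HodgeTheory
open Literature.AlgebraicGeometry.ComplexMultiplication (IsCMTypeRealisation)
open Literature.AlgebraicGeometry.Pohlmann1968

/-! ### §1 Restriction to a subfield containing the trace is a fine equivariant pivot -/

section Pivot

variable {I : Type} {K : I → Type} [∀ i, Field (K i)] [∀ i, NumberField (K i)] {T : Type} [Field T]

omit [∀ i, NumberField (K i)] in
/-- Restriction of embeddings to a subfield is `Aut(ℂ)`-equivariant: `(g ∘ t)|_T = g ∘ (t|_T)`. [folklore] -/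
theorem smul_comp_algebraMap {i₀ : I} [Algebra T (K i₀)] (g : ℂ ≃+* ℂ) (t : K i₀ →+* ℂ) :
    (g • t).comp (algebraMap T (K i₀)) = g • t.comp (algebraMap T (K i₀)) :=
  rfl

/-- **(TR) makes restriction to `T` FINER than the trace classes**: if `a(k) ∈ L₁` forces `k ∈ T` for every embedding
`a` of `K_{i₀}`, two embeddings agreeing on `T` agree on the trace `t⁻¹(L₁)`, hence differ by an automorphism of `ℂ`
fixing every embedding of `K_{i₁}` (gen 65 C2). [cite: Lang2002, VI §1 Thm. 1.1, Cor. 1.6 and V §2 Thm. 2.8] -/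
theorem exists_stab_smul_eq_of_comp_eq_of_trace_le {i₀ : I} (i₁ : I) [Algebra T (K i₀)]
    (htr : ∀ (a : K i₀ →+* ℂ) (k : K i₀), a k ∈ normalClosure ℚ (K i₁) ℂ → k ∈ Set.range (algebraMap T (K i₀)))
    (t t' : K i₀ →+* ℂ) (htt' : t.comp (algebraMap T (K i₀)) = t'.comp (algebraMap T (K i₀))) :
    ∃ n : ℂ ≃+* ℂ, (∀ y : K i₁ →+* ℂ, n • y = y) ∧ n • t = t' := by
  refine (exists_stab_smul_eq_iff_forall_apply_eq i₁ t t').2 fun k hk => ?_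
  obtain ⟨k₀, rfl⟩ := htr t k hk
  exact (RingHom.congr_fun htt' k₀).symm

/-- (TR) holds for `T = K_{i₀}` itself (the identity pivot). [folklore] -/
theorem trace_le_self {i₀ : I} (i₁ : I) (a : K i₀ →+* ℂ) (k : K i₀)
    (_hk : a k ∈ normalClosure ℚ (K i₁) ℂ) : k ∈ Set.range (algebraMap (K i₀) (K i₀)) :=
  ⟨k, rfl⟩

end Pivot

/-! ### §2 The defect is a function of the shadow -/

section Defect

variable {I : Type} [Fintype I] {K : I → Type} [∀ i, Field (K i)] [∀ i, NumberField (K i)] [∀ i, IsCMField (K i)]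
  {T : Type} [Field T]

/-- **THE DEFECT IS A FUNCTION OF THE SHADOW**: for a subfield `T ⊆ K_{i₀}` containing the trace (TR),
**`cmTypeRank Φ₀ + cmTypeRank Φ₁ = cmFamilyRank Φ + 1 + dim(span{g ↦ w₀(g ∘ y) : y ∈ Hom(T,ℂ)} ∩ MC₁)`**, where
`w₀(y′) = Σ_{t|_T = y′} u₀(t)` is the shadow of `Φ₀` on `Hom(T, ℂ)` and `MC₁ = span{g ↦ u₁(g ∘ x)}` — i.e.
**`dim Hg(A₀) + dim Hg(A₁) − dim Hg(A₀ × A₁)` depends on `Φ₀` only through its shadow on `T`.**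
[cite: Gordon1999HodgeAVSurvey, §3 Theorem, 7.5–7.7 and 9.4.3] [cite: Lang2002, VI §1 Thm. 1.1 and Cor. 1.6] -/
theorem cmTypeRank_add_cmTypeRank_eq_cmFamilyRank_add_one_add_finrank_shadow_inf {i₀ i₁ : I} (h01 : i₀ ≠ i₁)
    (hI : ∀ l, l = i₀ ∨ l = i₁) (Φ : ∀ i, CMType (K i)) [Algebra T (K i₀)]
    (htr : ∀ (a : K i₀ →+* ℂ) (k : K i₀), a k ∈ normalClosure ℚ (K i₁) ℂ → k ∈ Set.range (algebraMap T (K i₀))) :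
    cmTypeRank (Φ i₀) + cmTypeRank (Φ i₁) = CMAlgebra.cmFamilyRank Φ + 1 +
      Module.finrank ℚ (Submodule.span ℚ (Set.range fun y : T →+* ℂ => fun g : ℂ ≃+* ℂ =>
            ∑ t ∈ Finset.univ.filter (fun t : K i₀ →+* ℂ => t.comp (algebraMap T (K i₀)) = g • y),
              antiVec (Φ i₀).1 (1 : ℂ ≃+* ℂ) t) ⊓
          Submodule.span ℚ (Set.range fun x : K i₁ →+* ℂ => fun g : ℂ ≃+* ℂ => antiVec (Φ i₁).1 g x) :
        Submodule ℚ ((ℂ ≃+* ℂ) → ℚ)) := by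
  haveI : ∀ i, Nonempty (K i →+* ℂ) := fun i => inferInstance
  exact IrrOdd.typeRank_add_typeRank_eq_add_finrank_shadowCoeff_inf_of_fine (G := ℂ ≃+* ℂ)
    (E := fun i => K i →+* ℂ) (Φ := fun i => (Φ i).1) (fun i => isCMTypeWith_conj (Φ i)) hI h01
    (fun t : K i₀ →+* ℂ => t.comp (algebraMap T (K i₀))) (fun _ _ => rfl)
    (exists_stab_smul_eq_of_comp_eq_of_trace_le i₁ htr)

/-- **`Hg(A₀ × A₁) = Hg(A₀) × Hg(A₁)` IFF `span{g ↦ w₀(g ∘ y)} ∩ MC₁ = 0`** (shadow form, `T ⊇` trace).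
[cite: Gordon1999HodgeAVSurvey, §3 Theorem and 7.5–7.7] -/
theorem cmFamilyRank_add_card_eq_pair_iff_shadow_inf_eq_bot {i₀ i₁ : I} (h01 : i₀ ≠ i₁)
    (hI : ∀ l, l = i₀ ∨ l = i₁) (Φ : ∀ i, CMType (K i)) [Algebra T (K i₀)]
    (htr : ∀ (a : K i₀ →+* ℂ) (k : K i₀), a k ∈ normalClosure ℚ (K i₁) ℂ → k ∈ Set.range (algebraMap T (K i₀))) :
    CMAlgebra.cmFamilyRank Φ + Fintype.card I = (∑ i, cmTypeRank (Φ i)) + 1 ↔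
      Submodule.span ℚ (Set.range fun y : T →+* ℂ => fun g : ℂ ≃+* ℂ =>
            ∑ t ∈ Finset.univ.filter (fun t : K i₀ →+* ℂ => t.comp (algebraMap T (K i₀)) = g • y),
              antiVec (Φ i₀).1 (1 : ℂ ≃+* ℂ) t) ⊓
          Submodule.span ℚ (Set.range fun x : K i₁ →+* ℂ => fun g : ℂ ≃+* ℂ => antiVec (Φ i₁).1 g x) =
        (⊥ : Submodule ℚ ((ℂ ≃+* ℂ) → ℚ)) := by
  haveI : ∀ i, Nonempty (K i →+* ℂ) := fun i => inferInstance
  have h := IrrOdd.typeRank_sigmaType_add_card_eq_iff_fibreSum_inf_eq_bot_of_fine (G := ℂ ≃+* ℂ)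
    (E := fun i => K i →+* ℂ) (Φ := fun i => (Φ i).1) (fun i => isCMTypeWith_conj (Φ i)) hI h01
    (fun t : K i₀ →+* ℂ => t.comp (algebraMap T (K i₀))) (exists_stab_smul_eq_of_comp_eq_of_trace_le i₁ htr)
  rw [IrrOdd.span_fibreSum_eq_span_shadowCoeff (G := ℂ ≃+* ℂ) ((Φ i₀).1)
    (fun t : K i₀ →+* ℂ => t.comp (algebraMap T (K i₀))) (fun _ _ => rfl)] at h
  exact h

/-- **SAME SHADOW ⟹ SAME DEFECT**: two families with the same partner type `Φ₁` whose slot-`i₀` types have the same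
shadow on `T` (`T ⊇` trace) satisfy `cmTypeRank Φ₀ + cmFamilyRank Φ′ = cmTypeRank Φ₀′ + cmFamilyRank Φ`, i.e.
`dim Hg(A₀) + dim Hg(A₁) − dim Hg(A₀ × A₁) = dim Hg(A₀′) + dim Hg(A₁) − dim Hg(A₀′ × A₁)`.
[cite: Gordon1999HodgeAVSurvey, §3 Theorem, 7.5–7.7 and 9.4.3] -/
theorem cmTypeRank_add_cmFamilyRank_eq_of_shadow_eq {i₀ i₁ : I} (h01 : i₀ ≠ i₁) (hI : ∀ l, l = i₀ ∨ l = i₁)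
    (Φ Φ' : ∀ i, CMType (K i)) [Algebra T (K i₀)]
    (htr : ∀ (a : K i₀ →+* ℂ) (k : K i₀), a k ∈ normalClosure ℚ (K i₁) ℂ → k ∈ Set.range (algebraMap T (K i₀)))
    (h1 : Φ' i₁ = Φ i₁)
    (hw : ∀ y : T →+* ℂ,
      ∑ t ∈ Finset.univ.filter (fun t : K i₀ →+* ℂ => t.comp (algebraMap T (K i₀)) = y),
          antiVec (Φ i₀).1 (1 : ℂ ≃+* ℂ) t =
        ∑ t ∈ Finset.univ.filter (fun t : K i₀ →+* ℂ => t.comp (algebraMap T (K i₀)) = y),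
          antiVec (Φ' i₀).1 (1 : ℂ ≃+* ℂ) t) :
    cmTypeRank (Φ i₀) + CMAlgebra.cmFamilyRank Φ' = cmTypeRank (Φ' i₀) + CMAlgebra.cmFamilyRank Φ := by
  have h := cmTypeRank_add_cmTypeRank_eq_cmFamilyRank_add_one_add_finrank_shadow_inf h01 hI Φ htr
  have h' := cmTypeRank_add_cmTypeRank_eq_cmFamilyRank_add_one_add_finrank_shadow_inf h01 hI Φ' htr
  have hS : (fun y : T →+* ℂ => fun g : ℂ ≃+* ℂ =>
      ∑ t ∈ Finset.univ.filter (fun t : K i₀ →+* ℂ => t.comp (algebraMap T (K i₀)) = g • y),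
        antiVec (Φ i₀).1 (1 : ℂ ≃+* ℂ) t) =
      fun y : T →+* ℂ => fun g : ℂ ≃+* ℂ =>
        ∑ t ∈ Finset.univ.filter (fun t : K i₀ →+* ℂ => t.comp (algebraMap T (K i₀)) = g • y),
          antiVec (Φ' i₀).1 (1 : ℂ ≃+* ℂ) t :=
    funext fun y => funext fun g => hw (g • y)
  rw [hS] at h
  rw [h1] at h'
  omega

end Defect

/-! ### §3 The shadows of the CM types of `K₀ ⊇ T`: parity, oddness, surjectivity -/

section Shadows

variable {K₀ : Type} [Field K₀] [NumberField K₀] [IsCMField K₀] {T : Type} [Field T] [NumberField T] [Algebra T K₀]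

omit [IsCMField K₀] [NumberField T] in
/-- Every fibre of restriction has `[K₀ : T]` points (tree: `card_fibre_eq_finrank`), function form.
[cite: MilneFT2022, Prop. 2.7 (a)] -/
theorem card_fibre_comp_algebraMap (y : T →+* ℂ) :
    (Finset.univ.filter (fun t : K₀ →+* ℂ => t.comp (algebraMap T K₀) = y)).card = Module.finrank T K₀ :=
  card_fibre_eq_finrank (K := K₀) y

omit [NumberField K₀] [IsCMField K₀] [NumberField T] [Algebra T K₀] in
/-- Complex conjugation is an involution on `Hom(T, ℂ)` (action form). [cite: Shimura1998, §18.1] -/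
theorem conj_smul_conj_smul_eq (y : T →+* ℂ) :
    (starRingAut : ℂ ≃+* ℂ) • (starRingAut : ℂ ≃+* ℂ) • y = y := by
  rw [conj_smul_eq_conjugate, conj_smul_eq_conjugate]
  exact ComplexEmbedding.involutive_conjugate T y

omit [NumberField K₀] [IsCMField K₀] [NumberField T] [Algebra T K₀] in
/-- A field without real embeddings: conjugation acts freely on `Hom(T, ℂ)`. [cite: Shimura1998, §18.1] -/
theorem conj_smul_ne_of_isTotallyComplex [IsTotallyComplex T] (y : T →+* ℂ) : (starRingAut : ℂ ≃+* ℂ) • y ≠ y := by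
  rw [conj_smul_eq_conjugate]
  exact fun h => IsTotallyComplex.complexEmbedding_not_isReal y (ComplexEmbedding.isReal_iff.2 h)

omit [IsCMField K₀] [NumberField T] in
/-- **PARITY OF THE SHADOW**: `w(y) = 2k − [K₀:T]` with `k = #(Φ₀ ∩ res⁻¹y) ≤ [K₀:T]`.
[cite: Gordon1999HodgeAVSurvey, 9.4.3] -/
theorem exists_shadow_eq_two_mul_sub_finrank (Φ₀ : CMType K₀) (y : T →+* ℂ) :
    ∃ k : ℕ, k ≤ Module.finrank T K₀ ∧
      ∑ t ∈ Finset.univ.filter (fun t : K₀ →+* ℂ => t.comp (algebraMap T K₀) = y),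
          antiVec Φ₀.1 (1 : ℂ ≃+* ℂ) t = 2 * (k : ℚ) - (Module.finrank T K₀ : ℚ) := by
  have h := IrrOdd.exists_fibre_shadow_eq_two_mul_sub (G := ℂ ≃+* ℂ) Φ₀.1
    (fun t : K₀ →+* ℂ => t.comp (algebraMap T K₀)) y
  rwa [card_fibre_comp_algebraMap] at h

omit [IsCMField K₀] [NumberField T] in
/-- **ODD INDEX: no shadow entry vanishes** (`[K₀ : T]` odd ⟹ `w(y) ≠ 0` for every `y`).
[cite: Gordon1999HodgeAVSurvey, 9.4.3] -/
theorem shadow_ne_zero_of_odd_finrank (Φ₀ : CMType K₀) (hodd : Odd (Module.finrank T K₀)) (y : T →+* ℂ) :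
    ∑ t ∈ Finset.univ.filter (fun t : K₀ →+* ℂ => t.comp (algebraMap T K₀) = y),
        antiVec Φ₀.1 (1 : ℂ ≃+* ℂ) t ≠ 0 :=
  IrrOdd.fibre_shadow_ne_zero_of_odd (G := ℂ ≃+* ℂ) Φ₀.1 (fun t : K₀ →+* ℂ => t.comp (algebraMap T K₀)) y
    (by rwa [card_fibre_comp_algebraMap])

omit [IsCMField K₀] [NumberField T] in
/-- **EVEN INDEX: every shadow entry is even.** [cite: Gordon1999HodgeAVSurvey, 9.4.3] -/
theorem exists_shadow_eq_two_mul_of_even_finrank (Φ₀ : CMType K₀) (heven : Even (Module.finrank T K₀))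
    (y : T →+* ℂ) :
    ∃ z : ℤ, ∑ t ∈ Finset.univ.filter (fun t : K₀ →+* ℂ => t.comp (algebraMap T K₀) = y),
        antiVec Φ₀.1 (1 : ℂ ≃+* ℂ) t = 2 * (z : ℚ) :=
  IrrOdd.exists_fibre_shadow_eq_two_mul_of_even (G := ℂ ≃+* ℂ) Φ₀.1 (fun t : K₀ →+* ℂ => t.comp (algebraMap T K₀)) y
    (by rwa [card_fibre_comp_algebraMap])

omit [NumberField T] in
/-- **SHADOWS ARE ODD: `w(ȳ) = −w(y)`.** [cite: Shimura1998, §18.1] [cite: Gordon1999HodgeAVSurvey, 9.4.3] -/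
theorem shadow_conj_smul (Φ₀ : CMType K₀) (y : T →+* ℂ) :
    ∑ t ∈ Finset.univ.filter (fun t : K₀ →+* ℂ => t.comp (algebraMap T K₀) = (starRingAut : ℂ ≃+* ℂ) • y),
        antiVec Φ₀.1 (1 : ℂ ≃+* ℂ) t =
      -∑ t ∈ Finset.univ.filter (fun t : K₀ →+* ℂ => t.comp (algebraMap T K₀) = y),
        antiVec Φ₀.1 (1 : ℂ ≃+* ℂ) t :=
  IrrOdd.fibre_shadow_rho (G := ℂ ≃+* ℂ) (isCMTypeWith_conj Φ₀) (fun t : K₀ →+* ℂ => t.comp (algebraMap T K₀))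
    (fun _ => rfl) conj_smul_conj_smul_eq y

omit [NumberField T] in
/-- **FIBRE COUNTS OF A CM TYPE: `#(Φ₀ ∩ res⁻¹y) + #(Φ₀ ∩ res⁻¹ȳ) = [K₀ : T]`.** [cite: Gordon1999HodgeAVSurvey, 9.4.3] -/
theorem card_fibre_inter_add_card_fibre_inter_conj (Φ₀ : CMType K₀) (y : T →+* ℂ) :
    (Finset.univ.filter (fun t : K₀ →+* ℂ => t.comp (algebraMap T K₀) = y ∧ t ∈ Φ₀.1)).card +
        (Finset.univ.filter (fun t : K₀ →+* ℂ =>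
          t.comp (algebraMap T K₀) = (starRingAut : ℂ ≃+* ℂ) • y ∧ t ∈ Φ₀.1)).card =
      Module.finrank T K₀ := by
  rw [IrrOdd.card_fibre_inter_add_card_fibre_inter_rho (G := ℂ ≃+* ℂ) (isCMTypeWith_conj Φ₀)
    (fun t : K₀ →+* ℂ => t.comp (algebraMap T K₀)) (fun _ => rfl) conj_smul_conj_smul_eq y, card_fibre_comp_algebraMap]

omit [NumberField T] [Algebra T K₀] in
/-- A CM field carries a CM type (no embedding of a CM field is real). [cite: Shimura1998, §18.1 and §8.2 Prop. 26] -/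
theorem nonempty_cmType_of_isCMField : Nonempty (CMType K₀) :=
  nonempty_cmType_of_forall_conjugate_ne fun s h =>
    IsTotallyComplex.complexEmbedding_not_isReal s (ComplexEmbedding.isReal_iff.2 h)

/-- **SURJECTIVITY OF THE FIBRE COUNTS**: `T` without real embeddings; for every `k : Hom(T, ℂ) → ℕ` with
`k(y) + k(ȳ) = [K₀ : T]` there is a CM type of `K₀` meeting every fibre `res⁻¹y` in exactly `k(y)` embeddings.
[cite: Gordon1999HodgeAVSurvey, 9.4.3] [cite: Shimura1998, §18.1] -/
theorem exists_cmType_forall_card_fibre_inter_eq [IsTotallyComplex T] (k : (T →+* ℂ) → ℕ)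
    (hk : ∀ y : T →+* ℂ, k y + k ((starRingAut : ℂ ≃+* ℂ) • y) = Module.finrank T K₀) :
    ∃ Φ₀ : CMType K₀, ∀ y : T →+* ℂ,
      (Finset.univ.filter (fun t : K₀ →+* ℂ => t.comp (algebraMap T K₀) = y ∧ t ∈ Φ₀.1)).card = k y := by
  obtain ⟨Ψ⟩ := nonempty_cmType_of_isCMField (K₀ := K₀)
  have hΨ := isCMTypeWith_conj Ψ
  obtain ⟨Φ, hΦ, hcount⟩ := IrrOdd.exists_isCMTypeWith_forall_card_fibre_inter_eq (G := ℂ ≃+* ℂ) hΨ.comm hΨ.invol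
    (fun t : K₀ →+* ℂ => t.comp (algebraMap T K₀)) (fun _ => rfl) conj_smul_conj_smul_eq conj_smul_ne_of_isTotallyComplex
    card_fibre_comp_algebraMap k hk
  exact ⟨⟨Φ, fun φ => by rw [← conj_smul_eq_conjugate]; exact hΦ.mem_iff φ⟩, hcount⟩

/-- **SURJECTIVITY OF THE SHADOW**: every `k` with `k(y) + k(ȳ) = [K₀:T]` is realised as `w(y) = 2k(y) − [K₀:T]` —
THE SHADOWS OF THE CM TYPES OF `K₀` ON `T` ARE EXACTLY THE ODD WEIGHTS `w ≡ [K₀:T] (mod 2)`, `|w| ≤ [K₀:T]`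
(the `[K₀:T]`-fold sums of type vectors of `T`). [cite: Gordon1999HodgeAVSurvey, 9.4.3] [cite: Shimura1998, §18.1] -/
theorem exists_cmType_forall_shadow_eq [IsTotallyComplex T] (k : (T →+* ℂ) → ℕ)
    (hk : ∀ y : T →+* ℂ, k y + k ((starRingAut : ℂ ≃+* ℂ) • y) = Module.finrank T K₀) :
    ∃ Φ₀ : CMType K₀, ∀ y : T →+* ℂ,
      ∑ t ∈ Finset.univ.filter (fun t : K₀ →+* ℂ => t.comp (algebraMap T K₀) = y), antiVec Φ₀.1 (1 : ℂ ≃+* ℂ) t =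
        2 * (k y : ℚ) - (Module.finrank T K₀ : ℚ) := by
  obtain ⟨Φ₀, hΦ₀⟩ := exists_cmType_forall_card_fibre_inter_eq (K₀ := K₀) k hk
  refine ⟨Φ₀, fun y => ?_⟩
  have h := IrrOdd.fibre_shadow_eq_two_mul_card_sub_card (G := ℂ ≃+* ℂ) Φ₀.1
    (fun t : K₀ →+* ℂ => t.comp (algebraMap T K₀)) y
  beta_reduce at h
  rw [hΦ₀ y, card_fibre_comp_algebraMap] at h
  exact h

/-- **PADDING: `[K₀ : T] = [K₀′ : T] + 2d` ⟹ every shadow of a CM type of `K₀′` is the shadow of a CM type of `K₀`**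
(over each pair `{y, ȳ}` add `d` cancelling conjugate pairs of embeddings) — two CM fields over the same `T` without
real embeddings, the larger index of the same parity realises every shadow of the smaller.
[cite: Gordon1999HodgeAVSurvey, 9.4.3] [cite: Dodson1987, §1.1] -/
theorem exists_cmType_shadow_eq_of_finrank_eq_add [IsTotallyComplex T] {K₀' : Type} [Field K₀'] [NumberField K₀']
    [IsCMField K₀'] [Algebra T K₀'] (Φ₀' : CMType K₀') {d : ℕ}
    (hd : Module.finrank T K₀ = Module.finrank T K₀' + 2 * d) :
    ∃ Φ₀ : CMType K₀, ∀ y : T →+* ℂ,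
      ∑ t ∈ Finset.univ.filter (fun t : K₀ →+* ℂ => t.comp (algebraMap T K₀) = y), antiVec Φ₀.1 (1 : ℂ ≃+* ℂ) t =
        ∑ t ∈ Finset.univ.filter (fun t : K₀' →+* ℂ => t.comp (algebraMap T K₀') = y),
          antiVec Φ₀'.1 (1 : ℂ ≃+* ℂ) t := by
  obtain ⟨Ψ⟩ := nonempty_cmType_of_isCMField (K₀ := K₀)
  have hΨ := isCMTypeWith_conj Ψ
  obtain ⟨Φ, hΦ, hw⟩ := IrrOdd.exists_isCMTypeWith_fibre_shadow_eq_of_le_of_even (G := ℂ ≃+* ℂ) hΨ.comm hΨ.invol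
    (fun t : K₀ →+* ℂ => t.comp (algebraMap T K₀)) (fun _ => rfl) conj_smul_conj_smul_eq conj_smul_ne_of_isTotallyComplex
    card_fibre_comp_algebraMap (isCMTypeWith_conj Φ₀') (fun t : K₀' →+* ℂ => t.comp (algebraMap T K₀'))
    (fun _ => rfl) card_fibre_comp_algebraMap hd
  exact ⟨⟨Φ, fun φ => by rw [← conj_smul_eq_conjugate]; exact hΦ.mem_iff φ⟩, hw⟩

end Shadows

/-! ### §4 Monotone defect spectra across fields -/

section Monotone

variable {I : Type} [Fintype I] {K : I → Type} [∀ i, Field (K i)] [∀ i, NumberField (K i)] [∀ i, IsCMField (K i)]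
  {K' : I → Type} [∀ i, Field (K' i)] [∀ i, NumberField (K' i)] [∀ i, IsCMField (K' i)] {T : Type} [Field T]

omit [Fintype I] [∀ i, NumberField (K i)] [∀ i, IsCMField (K i)] [∀ i, NumberField (K' i)]
  [∀ i, IsCMField (K' i)] [Field T] in
/-- Transport of the matrix-coefficient space along a ring isomorphism of the partner fields with corresponding types.
[folklore] -/
theorem span_coeff_eq_of_ringEquiv {i₁ : I} (e : K' i₁ ≃+* K i₁) (Φ₁ : CMType (K i₁)) (Φ₁' : CMType (K' i₁))
    (hΦ₁ : ∀ t : K i₁ →+* ℂ, t ∈ Φ₁.1 ↔ t.comp e.toRingHom ∈ Φ₁'.1) :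
    Submodule.span ℚ (Set.range fun x : K' i₁ →+* ℂ => fun g : ℂ ≃+* ℂ => antiVec Φ₁'.1 g x) =
      Submodule.span ℚ (Set.range fun x : K i₁ →+* ℂ => fun g : ℂ ≃+* ℂ => antiVec Φ₁.1 g x) := by
  have hval : ∀ (g : ℂ ≃+* ℂ) (x : K i₁ →+* ℂ), antiVec Φ₁'.1 g (x.comp e.toRingHom) = antiVec Φ₁.1 g x := by
    intro g x
    have hmem : g • x.comp e.toRingHom ∈ Φ₁'.1 ↔ g • x ∈ Φ₁.1 := (hΦ₁ (g • x)).symm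
    simp only [antiVec, translateInd, hmem]
  congr 1
  ext c
  constructor
  · rintro ⟨x', rfl⟩
    refine ⟨x'.comp e.symm.toRingHom, funext fun g => ?_⟩
    show antiVec Φ₁.1 g (x'.comp e.symm.toRingHom) = antiVec Φ₁'.1 g x'
    rw [← hval g (x'.comp e.symm.toRingHom)]
    congr 1
    exact RingHom.ext fun z => by simp
  · rintro ⟨x, rfl⟩
    exact ⟨x.comp e.toRingHom, funext fun g => hval g x⟩

/-- **EQUAL SHADOWS ⟹ EQUAL DEFECTS, ACROSS FIELDS**: two pairs `(K_{i₀}, K_{i₁})`, `(K′_{i₀}, K′_{i₁})` with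
`K′_{i₁} ≅ K_{i₁}` and corresponding partner types, subfields `T ⊆ K_{i₀}`, `T ⊆ K′_{i₀}` both containing the traces
(TR), and slot-`i₀` types with the SAME SHADOW on `T`:
`cmTypeRank Φ₀ + cmFamilyRank Φ′ = cmTypeRank Φ₀′ + cmFamilyRank Φ`, i.e. the defects
`dim Hg(A₀) + dim Hg(A₁) − dim Hg(A₀ × A₁)` and `dim Hg(A₀′) + dim Hg(A₁) − dim Hg(A₀′ × A₁)` coincide.
[cite: Gordon1999HodgeAVSurvey, §3 Theorem, 7.5–7.7 and 9.4.3] -/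
theorem cmTypeRank_add_cmFamilyRank_eq_of_shadow_eq_of_ringEquiv {i₀ i₁ : I} (h01 : i₀ ≠ i₁)
    (hI : ∀ l, l = i₀ ∨ l = i₁) (Φ : ∀ i, CMType (K i)) (Φ' : ∀ i, CMType (K' i)) [Algebra T (K i₀)]
    [Algebra T (K' i₀)] (e : K' i₁ ≃+* K i₁)
    (hΦ₁ : ∀ t : K i₁ →+* ℂ, t ∈ (Φ i₁).1 ↔ t.comp e.toRingHom ∈ (Φ' i₁).1)
    (htr : ∀ (a : K i₀ →+* ℂ) (k : K i₀), a k ∈ normalClosure ℚ (K i₁) ℂ → k ∈ Set.range (algebraMap T (K i₀)))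
    (htr' : ∀ (a : K' i₀ →+* ℂ) (k : K' i₀), a k ∈ normalClosure ℚ (K' i₁) ℂ →
      k ∈ Set.range (algebraMap T (K' i₀)))
    (hw : ∀ y : T →+* ℂ,
      ∑ t ∈ Finset.univ.filter (fun t : K i₀ →+* ℂ => t.comp (algebraMap T (K i₀)) = y),
          antiVec (Φ i₀).1 (1 : ℂ ≃+* ℂ) t =
        ∑ t ∈ Finset.univ.filter (fun t : K' i₀ →+* ℂ => t.comp (algebraMap T (K' i₀)) = y),
          antiVec (Φ' i₀).1 (1 : ℂ ≃+* ℂ) t) :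
    cmTypeRank (Φ i₀) + CMAlgebra.cmFamilyRank Φ' = cmTypeRank (Φ' i₀) + CMAlgebra.cmFamilyRank Φ := by
  have h := cmTypeRank_add_cmTypeRank_eq_cmFamilyRank_add_one_add_finrank_shadow_inf h01 hI Φ htr
  have h' := cmTypeRank_add_cmTypeRank_eq_cmFamilyRank_add_one_add_finrank_shadow_inf h01 hI Φ' htr'
  rw [span_coeff_eq_of_ringEquiv e (Φ i₁) (Φ' i₁) hΦ₁] at h'
  have hS : (fun y : T →+* ℂ => fun g : ℂ ≃+* ℂ =>
      ∑ t ∈ Finset.univ.filter (fun t : K i₀ →+* ℂ => t.comp (algebraMap T (K i₀)) = g • y),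
        antiVec (Φ i₀).1 (1 : ℂ ≃+* ℂ) t) =
      fun y : T →+* ℂ => fun g : ℂ ≃+* ℂ =>
        ∑ t ∈ Finset.univ.filter (fun t : K' i₀ →+* ℂ => t.comp (algebraMap T (K' i₀)) = g • y),
          antiVec (Φ' i₀).1 (1 : ℂ ≃+* ℂ) t :=
    funext fun y => funext fun g => hw (g • y)
  rw [hS] at h
  -- the partner ranks agree
  have hr : cmTypeRank (Φ' i₁) = cmTypeRank (Φ i₁) := by
    change typeRank (ℂ ≃+* ℂ) (Φ' i₁).1 = typeRank (ℂ ≃+* ℂ) (Φ i₁).1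
    rw [(isCMTypeWith_conj (Φ' i₁)).typeRank_eq_finrank_antiSpan_add_one,
      (isCMTypeWith_conj (Φ i₁)).typeRank_eq_finrank_antiSpan_add_one,
      IrrOdd.finrank_antiSpan_eq_finrank_span_coeff, IrrOdd.finrank_antiSpan_eq_finrank_span_coeff,
      span_coeff_eq_of_ringEquiv e (Φ i₁) (Φ' i₁) hΦ₁]
  omega

end Monotone

end Summit.HodgeConjecture.CorCM

end
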